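import Literature.AnabelianGeometry.EtaleTheta.ThetaCoversLampModelTempered
import Literature.AnabelianGeometry.EtaleTheta.Discharge.Sec2LampModelDiscreteNormalizers
import Literature.AnabelianGeometry.EtaleTheta.Discharge.Sec2Lem217iiClosureRefuted
import Literature.AnabelianGeometry.EtaleTheta.Lem217iiNecessary
import Literature.AnabelianGeometry.EtaleTheta.Discharge.Sec2TemperedCoverDataModelHeis

/-!
# [EtTh] Lemma 2.17 (ii) as typed (`TemperedCoverData.Lem217_ii`, FACT-LIST F-0606) HOLDS at the lamplighter model —
# the INSTANCE form of F-0606 is INHABITED; with abc-iut-f-142's `not_forall_lem217_ii` the row is INDEPENDENT of the interface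

S. Mochizuki, *The étale theta function and its Frobenioid-theoretic manifestations*, Publ. RIMS **45** (2009) [MochizukiEtTh2009],
§2, Lemma 2.17 (ii), PDF p. 58: «for `Π` the tempered fundamental group of a hyperbolic orbicurve over a finite extension of `ℚ_p` and
`H ⊆ Π` an open subgroup, `N_{Π̂}(H) = N_Π(H)`» [cite: MochizukiEtTh2009, Lem 2.17(ii) p.58].  abc-iut-L2-t2 typed it over the
interface `T : ThetaCovers.TemperedCoverData l` as `T.Lem217_ii := ∀ H open in Π^tp_C, N_{Π_C}(toHat H) = toHat(N_{Π^tp_C}(H))`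
(FACT-LIST **F-0606**, `parametrised` schema: consumed BY NAME at instances, FACT-LIST rule R5).  abc-iut cell, block F (instance
forms; plan/F-INST59-NEXT.tsv row F-0606 «conditional closers only», KEY INST59J1), seat abc-iut-f-142 (tranche 142 owns F-0606).
PROOF-ONLY companion (0 definitions) of `ThetaCoversLampModelTempered.lean` (`lampModel`) and
`Discharge/Sec2LampModelDiscreteNormalizers.lean` (`normalizer_map_toHat`).

WHAT IS PROVED (every odd `l`; `l ≠ 0` as an instance):
* **`lem217_ii_lampModel : TemperedCoverData.Lem217_ii (lampModel l hl)`** — the typed Lemma 2.17 (ii) HOLDS at the model,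
  for ALL open `H` (finite index or not);
* `hasMuL_lampModel`, `hTheta_lampModel` — the model also satisfies `K ⊇ μ_l` and the printed definition of `Δ̄_Θ`
  (`⁅Δ_X, Δ_X⁆ · Ker = Δ̄_Θ-preimage`, GAP-LEDGER G-L2d3-1), so the instance is not an artefact of degenerate side data;
* `not_isCompact_PiYtp_lampModel` — consistency with abc-iut-f-108's necessary condition (`Lem217iiNecessary.lean`);
* **`lem217_ii_independent`** — `(∃ T, T.Lem217_ii ∧ T.HasMuL) ∧ ¬ ∀ T, T.Lem217_ii`: the census pair for F-0606
  (positive: this model; negative: abc-iut-w5-d118's NV-L2 model via abc-iut-f-142's `TemperedModel.not_forall_lem217_ii`);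
* `lem217_ii_lampModel_three` — the closed instance `l = 3`.
READING.  The interface `TemperedCoverData` does not force the tempered topology of `Π^tp_C` to be «discrete normaliser»-friendly
(NV-L2: discrete `Π^tp_C`, the row fails) nor -hostile (here: a prodiscrete-by-`ℤ` carrier, the row holds); the cone consumes
Lemma 2.17 (ii) BY NAME (`Lem217_ii_of_tower`, abc-iut's `Sec2DiscreteNormalizersHolds.lean`, modulo `IsTempered` + the free tower).

HONEST FRAMING. A DESIGNED consistency witness for OUR typed interface (`G_K = 1`; lamplighter groups, not
fundamental groups of curves): it decides which typed sentences are CONSEQUENCES of the interface and which are not;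
nothing of [EtTh] is asserted or denied for genuine tempered fundamental groups; instance-at-a-designed-carrier ≠ the
printed lemma; no side is taken on [IUTchIII] Cor. 3.12 or on any author; nothing here bears on abc. typed ≠ proved.
-/

noncomputable section

namespace Literature.AnabelianGeometry.EtaleTheta

namespace ThetaCovers

namespace LampModel

section Part_5

open HeisenbergWitness TemperedModel

variable (l : ℕ) [NeZero l]

/-- **F-0606 INSTANCE: the typed [EtTh] Lemma 2.17 (ii) HOLDS at the lamplighter model** — for EVERY open subgroup
`H ⊆ Π^tp_C` (finite index or not), `N_{Π_C}(toHatL H) = toHatL(N_{Π^tp_C}(H))` (abc-iut-L2-t2's `TemperedCoverData.Lem217_ii`,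
stated with its FULLY-QUALIFIED type). Instance-at-OUR-designed-carrier ≠ [EtTh] Lemma 2.17 (ii) for the tempered
fundamental group of a hyperbolic orbicurve; no claim about print. [cite: MochizukiEtTh2009, Lem 2.17(ii) p.58] -/
theorem lem217_ii_lampModel (hl : Odd l) :
    Literature.AnabelianGeometry.EtaleTheta.ThetaCovers.TemperedCoverData.Lem217_ii (lampModel l hl) :=
  fun H hH => normalizer_map_toHatL l H hH

/-- `K ⊇ μ_l` (`HasMuL`, the standing hypothesis of Rmk. 2.6.1 / Cor. 2.9) holds at the model, so the instance is not
a degenerate-hypothesis artefact of the surrounding rows. [cite: MochizukiEtTh2009, Rmk 2.6.1 p.40] -/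
theorem hasMuL_lampModel (hl : Odd l) :
    Literature.AnabelianGeometry.EtaleTheta.ThetaCovers.TemperedCoverData.HasMuL (lampModel l hl) :=
  fun c _ ht => hasMuL_L l hl c ht

/-- The printed definition of `Δ̄_Θ` (`hΘ : ⁅Δ_X, Δ_X⁆ · Ker = Δ̄_Θ-preimage`, GAP-LEDGER G-L2d3-1 / v-next field
candidate `commutator_sup_barKer`) holds at the model (as at abc-iut-w5-d118's Heisenberg variant).
[cite: MochizukiEtTh2009, §1 p.12] -/
theorem hTheta_lampModel (hl : Odd l) :
    ⁅(lampModel l hl).toCoverData.DeltaX, (lampModel l hl).toCoverData.DeltaX⁆ ⊔ (lampModel l hl).barKer =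
      (lampModel l hl).barTheta := by
  change ⁅PiXL l ⊓ (1 : P l →* PUnit.{1}).ker, PiXL l ⊓ (1 : P l →* PUnit.{1}).ker⁆ ⊔ (Φ l).ker = ThetaL l
  rw [MonoidHom.ker_one, inf_top_eq, ← Subgroup.comap_map_eq, Subgroup.map_commutator, PiXL,
    Subgroup.map_comap_eq_self_of_surjective (Φ_surjective l), commutator_heisPiX l hl]
  rfl

/-- abc-iut-f-108's NECESSARY CONDITION (`Lem217iiNecessary.lean`: a serving carrier has NON-compact `Π^tp_Y`) is met:
`Π^tp_Y = heisPiX × Ker(deg)` of the model is not compact. [cite: MochizukiEtTh2009, Lem 2.17(ii) p.58] -/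
theorem not_isCompact_PiYtp_lampModel (hl : Odd l) :
    ¬ IsCompact ((lampModel l hl).PiYtp : Set (lampModel l hl).Gtp) :=
  (lampModel l hl).lem217_ii_imp_not_isCompact_PiYtp (lem217_ii_lampModel l hl)

/-- **CENSUS PAIR for FACT-LIST F-0606** (abc-iut-L2-t2's `Lem217_ii`, a `parametrised` schema over
`T : TemperedCoverData l`): the typed Lemma 2.17 (ii) is INDEPENDENT of the interface — it HOLDS (with `HasMuL`) at the
lamplighter model and FAILS at abc-iut-w5-d118's NV-L2 model (abc-iut-f-142, `Sec2Lem217iiClosureRefuted`,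
`not_forall_lem217_ii`). For every odd `l`. [cite: MochizukiEtTh2009, Lem 2.17(ii) p.58] -/
theorem lem217_ii_independent (hl : Odd l) :
    (∃ T : TemperedCoverData.{0} l, T.Lem217_ii ∧ T.HasMuL) ∧ ¬ ∀ T : TemperedCoverData.{0} l, T.Lem217_ii :=
  ⟨⟨lampModel l hl, lem217_ii_lampModel l hl, hasMuL_lampModel l hl⟩, not_forall_lem217_ii l hl⟩

/-- The closed instance `l = 3`. [cite: MochizukiEtTh2009, Lem 2.17(ii) p.58] -/
theorem lem217_ii_lampModel_three :
    Literature.AnabelianGeometry.EtaleTheta.ThetaCovers.TemperedCoverData.Lem217_ii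
      (lampModel 3 (by decide)) :=
  lem217_ii_lampModel 3 _

end Part_5

end LampModel

end ThetaCovers

end Literature.AnabelianGeometry.EtaleTheta
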